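import Summits.MatrixMultiplication.OmegaCensus.STPPSmallPatternNone211K6Below27
import Summits.MatrixMultiplication.OmegaCensus.STPPSmallPatternT1K6OrderLaw
import Summits.MatrixMultiplication.OmegaCensus.STPPSmallPatternNone211K6Z27
import Summits.MatrixMultiplication.OmegaCensus.STPPSmallPatternNone211K6P3x9
import Summits.MatrixMultiplication.OmegaCensus.STPPSmallPatternNone211K6P3x3x3
import Summits.MatrixMultiplication.OmegaCensus.STPPSmallPatternNone211K6Z28
import Summits.MatrixMultiplication.OmegaCensus.STPPSmallPatternNone211K6P2x14
import Summits.MatrixMultiplication.OmegaCensus.STPPSmallPatternNone211K6Z29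

/-!
# ω-census, small STPP pattern `(2,1,1)^k`: the `k = 6` ORDER LAW as an iff — `(2,1,1)⁶ ⊆ G ↔ 30 ≤ |G|` (kernel)

HONEST FRAMING (pub-omega census; verbatim): lottery ticket; floor = certified bounds/negative ranges.
Census STRUCTURE bookkeeping of the STPP track (seat pub-omega-eng2 = ENG2, gen 34; STRUCTURE row B5, the threshold column
`T1(H) = max {k : (2,1,1)^k ⊆ H}`), not progress on `ω`: small patterns in small groups bound no exponent.

Second (last) tranche of the twelve-cell NONE side: the SIX abelian groups of order `27, 28, 29` — `ℤ/27`, `ℤ/3 × ℤ/9`, `(ℤ/3)³`,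
`ℤ/28`, `ℤ/2 × ℤ/14`, `ℤ/29` — each a kernel mask search with the stabiliser normal form and global exclusion mask
(`STPPSmallPatternNone211K6*.lean`, engine/reflection `STPPSmallPatternKernelSearchStab.lean`), assembled over ALL finite abelian
groups by the window bridge `not_exists_isSTPP_211_of_card_window45` and the first tranche `not_exists_isSTPP_211pow6_of_card_le_26`:

* `not_exists_isSTPP_211pow6_of_card_le_29` — no finite abelian group of order `≤ 29` admits `(2,1,1)⁶`;
* `stpp211pow6_iff_card` — **a finite abelian group `G` admits an STPP family of size pattern `(2,1,1)⁶` (CKSU Def. 5.1, tree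
  `IsSTPP`) if and only if `30 ≤ |G|`** (host side `exists_isSTPP_211pow6_of_card_ge_30`, `STPPSmallPatternT1K6OrderLaw.lean`).
  With `stpp211pow4_iff` and the `k = 5` law this is the third exact row of the `T1` onset column: `r_6 = 30`.

References: H. Cohn, R. Kleinberg, B. Szegedy, C. Umans, FOCS 2005 (arXiv:math/0511460), Def. 5.1.
-/

open Literature.Computability.AlgebraicComplexity Finset

namespace Summit.MatrixMultiplication.OmegaCensus

/-- The six abelian groups of order `27, 28, 29`, as lists of prime-power moduli (`SeedType`). -/
def noneLists211K6B : List (List ℕ) :=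
  [[27], [3, 9], [3, 3, 3], [4, 7], [2, 2, 7], [29]]

/-- COMBINATORIAL CORE (kernel): every capped multiset of prime powers with product in `[27, 29]` is one of the six types. -/
theorem noneList211K6B_of_capped : ∀ E ∈ List.range' 1 29, ∀ M ∈ subMS (capList E), 27 ≤ M.prod → M.prod ≤ 29 →
    ∃ s ∈ noneLists211K6B, dom s M = true ∧ s.prod = M.prod := by
  decide +kernel

/-- Each of the six groups admits no `(2,1,1)⁶` (the kernel cells; `ℤ/28` and `ℤ/2 × ℤ/14` through the CRT).
[cite: CohnKleinbergSzegedyUmans2005, Def. 5.1] -/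
theorem not_211pow6_of_mem_noneLists211K6B : ∀ s ∈ noneLists211K6B, ¬ ∃ A B C : Fin 6 → Finset (SeedType s),
    IsSTPP A B C ∧ ∀ i, (A i).card = 2 ∧ (B i).card = 1 ∧ (C i).card = 1 := by
  intro s hs
  simp only [noneLists211K6B, List.mem_cons, List.mem_nil_iff, or_false] at hs
  rcases hs with rfl | rfl | rfl | rfl | rfl | rfl
  · exact not_exists_isSTPP_211pow6_zmod27
  · exact not_exists_isSTPP_211pow6_z3_z9
  · exact not_exists_isSTPP_211pow6_z3_z3_z3
  · exact not_exists_isSTPP_211_seedPair (by norm_num) not_exists_isSTPP_211pow6_zmod28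
  · exact not_exists_isSTPP_211_seedTriple (by norm_num) not_exists_isSTPP_211pow6_z2_z14
  · exact not_exists_isSTPP_211pow6_zmod29

/-- **No finite abelian group of order `≤ 29` admits an STPP family of size pattern `(2,1,1)⁶`** (CKSU Def. 5.1, tree `IsSTPP`):
orders `≤ 26` by the first tranche, orders `27, 28, 29` by the six kernel cells through the structure theorem.  No `ω` bound
follows. [cite: CohnKleinbergSzegedyUmans2005, Def. 5.1] -/
theorem not_exists_isSTPP_211pow6_of_card_le_29 {G : Type*} [AddCommGroup G] [Finite G] (hG : Nat.card G ≤ 29) :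
    ¬ ∃ A B C : Fin 6 → Finset G, IsSTPP A B C ∧ ∀ i, (A i).card = 2 ∧ (B i).card = 1 ∧ (C i).card = 1 := by
  by_cases h27 : 27 ≤ Nat.card G
  · exact not_exists_isSTPP_211_of_card_window45 (by norm_num) noneList211K6B_of_capped
      not_211pow6_of_mem_noneLists211K6B h27 hG
  · exact not_exists_isSTPP_211pow6_of_card_le_26 (by omega)

/-- **THE `k = 6` ORDER LAW (iff): a finite abelian group `G` admits an STPP family of size pattern `(2,1,1)⁶` (CKSU Def. 5.1,
tree `IsSTPP`) if and only if `30 ≤ |G|`.**  (`r_6 = 30`: the least order of an abelian group hosting `(2,1,1)⁶`, attained by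
every abelian group of order `≥ 30`.)  No `ω` bound follows. [cite: CohnKleinbergSzegedyUmans2005, Def. 5.1] -/
theorem stpp211pow6_iff_card {G : Type*} [AddCommGroup G] [Finite G] :
    (∃ A B C : Fin 6 → Finset G, IsSTPP A B C ∧ ∀ i, (A i).card = 2 ∧ (B i).card = 1 ∧ (C i).card = 1) ↔ 30 ≤ Nat.card G :=
  ⟨fun h => by
    by_contra hlt
    exact not_exists_isSTPP_211pow6_of_card_le_29 (by omega) h,
  exists_isSTPP_211pow6_of_card_ge_30⟩

end Summit.MatrixMultiplication.OmegaCensus
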